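import Summits.AtomisticToContinuum.FouriersLaw.Theses.CoercivePulse
import Literature.MathematicalPhysics.KineticTheory.InfiniteChainGibbsMomentaIndependence
import Literature.MathematicalPhysics.KineticTheory.InfiniteChainEnergyDensityMoments
import Literature.MathematicalPhysics.KineticTheory.InfiniteChainGibbsExistenceShift
import Literature.MathematicalPhysics.KineticTheory.InfiniteChainShiftInvariantUniqueness
import Literature.MathematicalPhysics.KineticTheory.InfiniteChainSuperstableReversal
import Literature.MathematicalPhysics.KineticTheory.InfiniteChainGoodSetSymmetries
import HarnessLib

/-!
# Negative lemma for crux `CoercivePulse.LinearCeiling` (item stmt-AtomisticToContinuum-15383):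
# the hypothesis `D.PreservesMeasure μ` is load-bearing

`--supports` file on the Negative lane (refuter seat `refuter-cdisprove-stmt-AtomisticToContinuum-15383-0`,
cycle 1, 2026-08-17); closes nothing, asserts no Theses statement. Theorems only.

MAIN RESULT `linearCeiling_false_without_preservesMeasure`: the crux `CoercivePulse.LinearCeiling` with the
single hypothesis `D.PreservesMeasure μ` deleted (everything else verbatim) is FALSE. Reason: the structure
`InfiniteChainDynamics P` has the junk inhabitant `carrier = ∅` — all four fields are then vacuous and the
flow is arbitrary; only the clause `∀ᵐ σ ∂μ, σ ∈ D.carrier` of `PreservesMeasure` ties a dynamics to the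
equations of motion. Witness: on the honest shift-invariant DLR state `μ` of `pinnedChain 1 1 1 0` at
`T = 1`, the momentum-injection flow `φ_t σ = (x ↦ (0, t·p_{x-1}(σ)))` commutes with the shift, its pulse
is `S(x,t) = c t² 𝟙{x = 1}` with `c = ½(∫ h_0 p_0² dμ − ∫ h_0 dμ) = ¼ Var_μ(p_0²) > 0` (LLL 1977 §4 remark
(ii): `p_y` is `N(0,T)` and independent of everything else — `IsChainGibbsMeasure.lintegral_snd_mul`,
`integral_snd_mul_snd_mul`, `map_snd`), so `M(t) = c t²` and the anchored linear envelope fails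
(`not_anchoredLinearEnvelope_of_quadratic`).

BY-PRODUCT `map_reversal_eq_of_gibbs_shiftInvariant`: the momentum-reversal hypothesis of the crux is
derivable from `IsChainGibbsMeasure` + `IsShiftInvariant` (uniqueness in the shift-invariant class +
superstability), i.e. it is decoration — provers may discharge it with this lemma.
-/

noncomputable section

namespace Summit.AtomisticToContinuum.FouriersLaw.Theorems.LinearCeiling.Negative

open MeasureTheory ProbabilityTheory Filter Set Function
open scoped Topology BigOperators ENNReal NNReal
open Literature.MathematicalPhysics.KineticTheory.HeatConduction

/-- **Quadratic growth violates every anchored linear envelope**: for `c > 0` there are no `b, t₃`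
with `c t² ≤ c t₃² + b (t − t₃)` for all `t ≥ t₃`. The real-variable content of every refutation of a
`LinearCeiling`-shaped statement (harmonic member: `M(t) ≈ 0.185 t²`; the junk dynamics of §1). [folklore] -/
theorem not_anchoredLinearEnvelope_of_quadratic {c : ℝ} (hc : 0 < c) :
    ¬ ∃ b t₃ : ℝ, ∀ t : ℝ, t₃ ≤ t → c * t ^ 2 ≤ c * t₃ ^ 2 + b * (t - t₃) := by
  rintro ⟨b, t₃, h⟩
  set t : ℝ := |t₃| + |b| / c + 1 with ht
  have h1 : t₃ < t := by
    have := le_abs_self t₃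
    have : 0 ≤ |b| / c := by positivity
    linarith
  have h2 : b < c * (t + t₃) := by
    have hb : b ≤ |b| := le_abs_self b
    have : |b| / c * c = |b| := div_mul_cancel₀ _ hc.ne'
    nlinarith [neg_abs_le t₃, abs_nonneg t₃]
  have h3 := h t h1.le
  nlinarith [mul_lt_mul_of_pos_left h2 (sub_pos.mpr h1)]

/-- The same kernel for an envelope functional `M` that IS `c t²`. [folklore] -/
theorem not_anchoredLinearEnvelope_of_eq_quadratic {c : ℝ} (hc : 0 < c) {M : ℝ → ℝ}
    (hM : ∀ t, M t = c * t ^ 2) :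
    ¬ ∃ b t₃ : ℝ, ∀ t : ℝ, t₃ ≤ t → M t ≤ M t₃ + b * (t - t₃) := by
  simp only [hM]
  exact not_anchoredLinearEnvelope_of_quadratic hc

/-- **Reversal invariance is automatic**: every shift-invariant DLR state of `pinnedChain ω₂ lam β γ`
(`ω₂ > 0`, `lam, β ≥ 0`) at `T > 0` is invariant under momentum reversal — uniqueness in the
shift-invariant class (`eq_of_isChainGibbsMeasure_of_isShiftInvariant_pinnedChain`) + superstability +
`map_momentumReversalZ_eq_of_regular_unique`. So hypothesis `hR` of the crux is decoration. [folklore] -/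
theorem map_reversal_eq_of_gibbs_shiftInvariant {ω₂ lam β : ℝ} (γ : ℝ) (hω : 0 < ω₂) (hl : 0 ≤ lam)
    (hβ : 0 ≤ β) {T : ℝ} (hT : 0 < T) {μ : Measure ChainConfig}
    (hG : (pinnedChain ω₂ lam β γ).IsChainGibbsMeasure T μ) (hSI : IsShiftInvariant μ) :
    μ.map (fun σ : ChainConfig => fun x : ℤ => ((σ x).1, -(σ x).2)) = μ := by
  have hss := OscillatorChain.hasSuperstabilityEstimate_of_isShiftInvariant_pinnedChain γ hω hl hβ hT hG hSI
  have h := OscillatorChain.map_momentumReversalZ_eq_of_regular_unique hG hSI hss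
    (fun μ₁ μ₂ h₁ hS₁ _ h₂ hS₂ _ =>
      OscillatorChain.eq_of_isChainGibbsMeasure_of_isShiftInvariant_pinnedChain γ hω hl hβ hT h₁ hS₁ h₂ hS₂)
  rw [coe_momentumReversalZ] at h
  exact h

/-- Updating the momentum at a site `i ≠ x` does not change the split-bond site energy `h_x`
(it reads `p_x` and the positions `q_{x-1}, q_x, q_{x+1}` only). [folklore] -/
theorem energyDensityZ_update_snd_of_ne' (P : OscillatorChain) (σ : ChainConfig) {i x : ℤ}
    (h : x ≠ i) (p : ℝ) :
    P.energyDensityZ (Function.update σ i ((σ i).1, p)) x = P.energyDensityZ σ x := by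
  have hq : ∀ z : ℤ, (Function.update σ i ((σ i).1, p) z).1 = (σ z).1 := fun z =>
    congrFun (positionField_update_snd σ i p) z
  unfold OscillatorChain.energyDensityZ
  simp only [hq, Function.update_of_ne h]

/-- **Fourth Gaussian moment exceeds the squared second one**: `1 < ∫ r⁴ dN(0,1)` (it is `3`; we only
need strictness, by `∫ (r² − 1)² dN > 0` and full support of the Gaussian). [folklore] -/
theorem one_lt_integral_pow_four_gaussianReal :
    1 < ∫ r, r ^ 4 ∂(gaussianReal 0 1) := by
  set ν : Measure ℝ := gaussianReal 0 1 with hν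
  have hi2 : Integrable (fun r : ℝ => r ^ 2) ν :=
    (memLp_two_iff_integrable_sq aestronglyMeasurable_id).1 (memLp_id_gaussianReal' (μ := 0) (v := 1) 2 (by norm_num))
  have hi4 : Integrable (fun r : ℝ => r ^ 4) ν := by
    have h4 : MemLp (fun r : ℝ => r) ((4 : ℕ) : ℝ≥0∞) ν := by
      rw [Nat.cast_ofNat]; exact memLp_id_gaussianReal' (μ := 0) (v := 1) 4 (by norm_num)
    refine (h4.integrable_norm_pow (by norm_num)).congr (Eventually.of_forall fun r => ?_)
    have h2 : |r| ^ 2 = r ^ 2 := sq_abs r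
    calc ‖r‖ ^ 4 = (|r| ^ 2) ^ 2 := by rw [Real.norm_eq_abs]; ring
      _ = r ^ 4 := by rw [h2]; ring
  have hsq : ∫ r, r ^ 2 ∂ν = 1 := by
    have h := OscillatorChain.integral_sq_gaussianReal (T := 1) zero_le_one
    rwa [Real.toNNReal_one] at h
  -- `∫ (r² - 1)² dν = ∫ r⁴ dν - 1`
  have hint : Integrable (fun r : ℝ => (r ^ 2 - 1) ^ 2) ν := by
    refine ((hi4.sub (hi2.const_mul 2)).add (integrable_const 1)).congr (Eventually.of_forall fun r => ?_)
    simp only [Pi.add_apply, Pi.sub_apply]; ring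
  have hexp : ∫ r, (r ^ 2 - 1) ^ 2 ∂ν = (∫ r, r ^ 4 ∂ν) - 1 := by
    have e : (fun r : ℝ => (r ^ 2 - 1) ^ 2) = fun r => (r ^ 4 - 2 * r ^ 2) + 1 := funext fun r => by ring
    haveI : IsProbabilityMeasure ν := by rw [hν]; infer_instance
    have i42 : Integrable (fun r : ℝ => r ^ 4 - 2 * r ^ 2) ν := hi4.sub (hi2.const_mul 2)
    have i2' : Integrable (fun r : ℝ => 2 * r ^ 2) ν := hi2.const_mul 2
    have h1 : ∫ _ : ℝ, (1 : ℝ) ∂ν = 1 := by simp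
    rw [e, integral_add i42 (integrable_const 1), integral_sub hi4 i2', integral_const_mul, hsq, h1]
    ring
  -- positivity of `∫ (r² - 1)² dν` from the full support of the Gaussian
  have hpos : 0 < ∫ r, (r ^ 2 - 1) ^ 2 ∂ν := by
    rw [integral_pos_iff_support_of_nonneg (fun r => sq_nonneg _) hint]
    have hsub : Set.Ioi (2 : ℝ) ⊆ Function.support fun r : ℝ => (r ^ 2 - 1) ^ 2 := fun r hr => by
      have hr2 : (2 : ℝ) < r := hr
      rw [Function.mem_support]
      exact pow_ne_zero 2 (by nlinarith)
    refine lt_of_lt_of_le ?_ (measure_mono hsub)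
    rw [pos_iff_ne_zero]
    intro h0
    have h := gaussianReal_absolutelyContinuous' (0 : ℝ) (v := 1) one_ne_zero h0
    simp only [Real.volume_Ioi] at h
    exact ENNReal.top_ne_zero h
  linarith

/-- **`D.PreservesMeasure μ` is load-bearing**: without it `LinearCeiling` is FALSE — the junk dynamics
`junkDynamics` on the (honest) shift-invariant DLR state of `pinnedChain 1 1 1 0` at `T = 1` has the
pulse `S(x,t) = c t² 𝟙{x = 1}` with `c = ½ Var_μ(p_0²) > 0`, hence `M(t) = c t²`. Any proof of the crux
must use that `D` preserves `μ` (more precisely: that `μ`-a.e. configuration lies in `D.carrier`). [folklore] -/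
theorem linearCeiling_false_without_preservesMeasure :
    ¬ (∀ ω₂ lam β γ : ℝ, 0 < ω₂ → 0 < lam → 0 < β → ∀ T : ℝ, 0 < T → ∀ μ : MeasureTheory.Measure Literature.MathematicalPhysics.KineticTheory.HeatConduction.ChainConfig, (Literature.MathematicalPhysics.KineticTheory.HeatConduction.pinnedChain ω₂ lam β γ).IsChainGibbsMeasure T μ → Literature.MathematicalPhysics.KineticTheory.HeatConduction.IsShiftInvariant μ → μ.map (fun σ : Literature.MathematicalPhysics.KineticTheory.HeatConduction.ChainConfig => fun x : ℤ => ((σ x).1, -(σ x).2)) = μ → ∀ D : Literature.MathematicalPhysics.KineticTheory.HeatConduction.InfiniteChainDynamics (Literature.MathematicalPhysics.KineticTheory.HeatConduction.pinnedChain ω₂ lam β γ), (∀ t : ℝ, ∀ᵐ σ ∂μ, D.flow t (Literature.MathematicalPhysics.KineticTheory.HeatConduction.shift σ) = Literature.MathematicalPhysics.KineticTheory.HeatConduction.shift (D.flow t σ)) → ∀ h : Literature.MathematicalPhysics.KineticTheory.HeatConduction.ChainConfig → ℤ → ℝ, h = (fun (σ : Literature.MathematicalPhysics.KineticTheory.HeatConduction.ChainConfig)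 (x : ℤ) => (σ x).2 ^ 2 / 2 + (Literature.MathematicalPhysics.KineticTheory.HeatConduction.pinnedChain ω₂ lam β γ).U (σ x).1 + ((Literature.MathematicalPhysics.KineticTheory.HeatConduction.pinnedChain ω₂ lam β γ).V ((σ (x + 1)).1 - (σ x).1) + (Literature.MathematicalPhysics.KineticTheory.HeatConduction.pinnedChain ω₂ lam β γ).V ((σ x).1 - (σ (x - 1)).1)) / 2) → ∀ S : ℤ → ℝ → ℝ, S = (fun (x : ℤ) (t : ℝ) => ∫ σ, (h σ 0 - ∫ σ', h σ' 0 ∂μ) * (h (D.flow t σ) x - ∫ σ', h σ' 0 ∂μ) ∂μ) → (∀ t : ℝ, Summable (fun x : ℤ => (1 + (x : ℝ) ^ 2) * |S x t|)) → ∃ b t₃ : ℝ, ∀ t : ℝ, t₃ ≤ t → ∑' x : ℤ, (x : ℝ) ^ 2 * S x t ≤ (∑' x : ℤ, (x : ℝ) ^ 2 * S x t₃) + b * (t - t₃)) := by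
  intro H
  -- the arena: the shift-invariant DLR state of `(pinnedChain (1 : ℝ) 1 1 0) = pinnedChain 1 1 1 0` at `T = 1`
  obtain ⟨μ, hG, hSI, -⟩ :=
    OscillatorChain.exists_isChainGibbsMeasure_shiftInvariant_superstable_pinnedChain
      (ω₂ := 1) (lam := 1) (β := 1) (T := 1) 0 one_pos zero_le_one zero_le_one one_pos
  have hR := map_reversal_eq_of_gibbs_shiftInvariant (0 : ℝ) one_pos zero_le_one zero_le_one one_pos hG hSI
  haveI : IsProbabilityMeasure μ := hG.isProbabilityMeasure
  have hUc : Continuous (pinnedChain (1 : ℝ) 1 1 0).U := by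
    show Continuous fun q : ℝ => 1 * q ^ 2 / 2 + 1 * q ^ 4 / 4
    fun_prop
  have hVc : Continuous (pinnedChain (1 : ℝ) 1 1 0).V := by
    show Continuous fun r : ℝ => r ^ 2 / 2 + 1 * r ^ 4 / 4
    fun_prop
  have hUm : Measurable (pinnedChain (1 : ℝ) 1 1 0).U := OscillatorChain.measurable_pinnedChain_U 1 1 1 0
  have hVm : Measurable (pinnedChain (1 : ℝ) 1 1 0).V := OscillatorChain.measurable_pinnedChain_V 1 1 1 0
  have hU0 : ∀ r, 0 ≤ (pinnedChain (1 : ℝ) 1 1 0).U r := OscillatorChain.pinnedChain_U_nonneg 1 0 zero_le_one zero_le_one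
  have hV0 : ∀ r, 0 ≤ (pinnedChain (1 : ℝ) 1 1 0).V r := OscillatorChain.pinnedChain_V_nonneg 1 1 0 zero_le_one
  have hss : (pinnedChain (1 : ℝ) 1 1 0).HasSuperstabilityEstimate μ :=
    OscillatorChain.hasSuperstabilityEstimate_of_isShiftInvariant_pinnedChain 0 one_pos zero_le_one
      zero_le_one one_pos hG hSI
  -- the site energy `h`, its mean `m`, the junk dynamics `D` and its pulse `S`
  set h : ChainConfig → ℤ → ℝ := fun σ x => (pinnedChain (1 : ℝ) 1 1 0).energyDensityZ σ x with hh
  set m : ℝ := ∫ σ, h σ 0 ∂μ with hm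
  -- the JUNK DYNAMICS: empty carrier (every field vacuous), momentum-injection flow
  set D : InfiniteChainDynamics (pinnedChain (1 : ℝ) 1 1 0) :=
    { carrier := ∅
      flow := fun t σ x => (0, t * (σ (x - 1)).2)
      mapsTo := fun _ => Set.mapsTo_empty _ _
      flow_zero := fun _ h => h.elim
      isSolution := fun _ h => h.elim
      unique := fun _ hγ _ _ => (hγ 0).elim } with hD
  set S : ℤ → ℝ → ℝ := fun x t => ∫ σ, (h σ 0 - m) * (h (D.flow t σ) x - m) ∂μ with hS
  -- the flowed site energy: `h_x(φ_t σ) = t² p_{x-1}² / 2`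
  have hflow : ∀ (t : ℝ) (σ : ChainConfig) (x : ℤ), h (D.flow t σ) x = t ^ 2 * (σ (x - 1)).2 ^ 2 / 2 := by
    intro t σ x
    have hU00 : (pinnedChain (1 : ℝ) 1 1 0).U 0 = 0 := by
      show (1 : ℝ) * 0 ^ 2 / 2 + 1 * 0 ^ 4 / 4 = 0
      norm_num
    have hV00 : (pinnedChain (1 : ℝ) 1 1 0).V 0 = 0 := by
      show (0 : ℝ) ^ 2 / 2 + 1 * 0 ^ 4 / 4 = 0
      norm_num
    show (t * (σ (x - 1)).2) ^ 2 / 2 + (pinnedChain (1 : ℝ) 1 1 0).U 0 + ((pinnedChain (1 : ℝ) 1 1 0).V (0 - 0) + (pinnedChain (1 : ℝ) 1 1 0).V (0 - 0)) / 2 = _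
    rw [sub_zero, hU00, hV00]
    ring
  -- moments: `p_y ∈ L⁴`, `p_y² ∈ L²`, `h_0 ∈ L²`
  have hmeas_p : ∀ y : ℤ, Measurable fun σ : ChainConfig => (σ y).2 := fun y => (measurable_pi_apply y).snd
  have hp_memLp4 : ∀ y : ℤ, MemLp (fun σ : ChainConfig => (σ y).2) ((4 : ℕ) : ℝ≥0∞) μ := fun y => by
    have hmap := hG.map_snd hUc hVc one_pos y
    have h4 : MemLp id ((4 : ℕ) : ℝ≥0∞) (μ.map fun σ : ChainConfig => (σ y).2) := by
      rw [hmap, Nat.cast_ofNat]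
      exact memLp_id_gaussianReal' 4 (by norm_num)
    exact (memLp_map_measure_iff aestronglyMeasurable_id (hmeas_p y).aemeasurable).1 h4
  have hp4 : ∀ y : ℤ, Integrable (fun σ : ChainConfig => (σ y).2 ^ 4) μ := fun y => by
    refine ((hp_memLp4 y).integrable_norm_pow (by norm_num)).congr (Eventually.of_forall fun σ => ?_)
    have h2 : |(σ y).2| ^ 2 = (σ y).2 ^ 2 := sq_abs _
    calc ‖(σ y).2‖ ^ 4 = (|(σ y).2| ^ 2) ^ 2 := by rw [Real.norm_eq_abs]; ring
      _ = (σ y).2 ^ 4 := by rw [h2]; ring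
  have hp2sq : ∀ y : ℤ, MemLp (fun σ : ChainConfig => (σ y).2 ^ 2) 2 μ := fun y =>
    (memLp_two_iff_integrable_sq ((hmeas_p y).pow_const 2).aestronglyMeasurable).2
      ((hp4 y).congr (Eventually.of_forall fun σ => by ring))
  have hp2 : ∀ y : ℤ, Integrable (fun σ : ChainConfig => (σ y).2 ^ 2) μ := fun y =>
    (hp2sq y).integrable one_le_two
  have hh2 : MemLp (fun σ => h σ 0) 2 μ :=
    OscillatorChain.memLp_energyDensityZ_pinnedChain 0 zero_le_one zero_le_one zero_le_one hss 0 (by norm_num)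
  have hh1 : Integrable (fun σ => h σ 0) μ := hh2.integrable one_le_two
  have hh0 : ∀ σ, 0 ≤ h σ 0 := fun σ => OscillatorChain.energyDensityZ_nonneg hU0 hV0 σ 0
  have hhm : Measurable fun σ => h σ 0 := (pinnedChain (1 : ℝ) 1 1 0).measurable_energyDensityZ hUm hVm 0
  have hm0 : 0 ≤ m := integral_nonneg hh0
  have hhp : ∀ y : ℤ, Integrable (fun σ => h σ 0 * (σ y).2 ^ 2) μ := fun y => hh2.integrable_mul (hp2sq y)
  have hconst : ∀ c : ℝ, ∫ _ : ChainConfig, c ∂μ = c := fun c => by simp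
  -- equipartition: `∫ p_y² dμ = 1`
  have hp2one : ∀ y : ℤ, ∫ σ, (σ y).2 ^ 2 ∂μ = 1 := fun y => by
    have h := hG.integral_snd_mul_snd_mul hUc hVc one_pos y (g := fun _ => (1 : ℝ)) measurable_const
    calc ∫ σ, (σ y).2 ^ 2 ∂μ
        = ∫ σ : ChainConfig, (σ y).2 * (σ y).2 * (fun _ : ℤ → ℝ => (1 : ℝ)) (fun x => (σ x).1) ∂μ :=
          integral_congr_ae (Eventually.of_forall fun σ => by simp only [mul_one]; ring)
      _ = 1 * ∫ σ : ChainConfig, (fun _ : ℤ → ℝ => (1 : ℝ)) (fun x => (σ x).1) ∂μ := h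
      _ = 1 := by simp
  -- (A1) independence: `∫ h_0 p_y² dμ = m` for `y ≠ 0`
  have hA1 : ∀ y : ℤ, y ≠ 0 → ∫ σ, h σ 0 * (σ y).2 ^ 2 ∂μ = m := by
    intro y hy
    have key := hG.lintegral_snd_mul hUc hVc one_pos y (φ := fun r => ENNReal.ofReal (r ^ 2))
      (ENNReal.measurable_ofReal.comp (measurable_id.pow_const 2))
      (G := fun σ => ENNReal.ofReal (h σ 0)) (ENNReal.measurable_ofReal.comp hhm)
      (fun σ p => by
        show ENNReal.ofReal ((pinnedChain (1 : ℝ) 1 1 0).energyDensityZ (Function.update σ y ((σ y).1, p)) 0) =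
          ENNReal.ofReal ((pinnedChain (1 : ℝ) 1 1 0).energyDensityZ σ 0)
        rw [energyDensityZ_update_snd_of_ne' (pinnedChain (1 : ℝ) 1 1 0) σ (Ne.symm hy) p])
    have e1 : ∫⁻ σ, ENNReal.ofReal ((σ y).2 ^ 2) * ENNReal.ofReal (h σ 0) ∂μ =
        ENNReal.ofReal (∫ σ, h σ 0 * (σ y).2 ^ 2 ∂μ) := by
      rw [ofReal_integral_eq_lintegral_ofReal (hhp y)
        (Eventually.of_forall fun σ => mul_nonneg (hh0 σ) (sq_nonneg _))]
      refine lintegral_congr fun σ => ?_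
      rw [← ENNReal.ofReal_mul (sq_nonneg _), mul_comm]
    have e2 : ∫⁻ p, ENNReal.ofReal (p ^ 2) ∂gaussianReal 0 (1 : ℝ).toNNReal = 1 := by
      have hi : Integrable (fun p : ℝ => p ^ 2) (gaussianReal 0 (1 : ℝ).toNNReal) :=
        (memLp_two_iff_integrable_sq aestronglyMeasurable_id).1 (memLp_id_gaussianReal' 2 (by norm_num))
      rw [← ofReal_integral_eq_lintegral_ofReal hi (Eventually.of_forall fun p => sq_nonneg p),
        OscillatorChain.integral_sq_gaussianReal zero_le_one, ENNReal.ofReal_one]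
    have e3 : ∫⁻ σ, ENNReal.ofReal (h σ 0) ∂μ = ENNReal.ofReal m :=
      (ofReal_integral_eq_lintegral_ofReal hh1 (Eventually.of_forall hh0)).symm
    rw [e1, e2, e3, one_mul] at key
    exact (ENNReal.ofReal_eq_ofReal_iff (integral_nonneg fun σ => mul_nonneg (hh0 σ) (sq_nonneg _)) hm0).1 key
  -- (A2) the on-site term: `c := ∫ h_0 p_0² dμ - m = ½ (∫ p_0⁴ dμ - 1) > 0`
  set Φ : ChainConfig → ℝ := fun σ => (pinnedChain (1 : ℝ) 1 1 0).U (σ 0).1 +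
    ((pinnedChain (1 : ℝ) 1 1 0).V ((σ (0 + 1)).1 - (σ 0).1) + (pinnedChain (1 : ℝ) 1 1 0).V ((σ 0).1 - (σ (0 - 1)).1)) / 2 with hΦdef
  set g₀ : (ℤ → ℝ) → ℝ := fun q => (pinnedChain (1 : ℝ) 1 1 0).U (q 0) + ((pinnedChain (1 : ℝ) 1 1 0).V (q (0 + 1) - q 0) + (pinnedChain (1 : ℝ) 1 1 0).V (q 0 - q (0 - 1))) / 2
    with hg₀def
  have hq : ∀ i : ℤ, Measurable fun q : ℤ → ℝ => q i := fun i => measurable_pi_apply i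
  have hg₀ : Measurable g₀ :=
    (hUm.comp (hq 0)).add (((hVm.comp ((hq (0 + 1)).sub (hq 0))).add
      (hVm.comp ((hq 0).sub (hq (0 - 1))))).div_const 2)
  have hΦ : ∀ σ, h σ 0 = (σ 0).2 ^ 2 / 2 + Φ σ := fun σ => by
    show (σ 0).2 ^ 2 / 2 + (pinnedChain (1 : ℝ) 1 1 0).U (σ 0).1 +
      ((pinnedChain (1 : ℝ) 1 1 0).V ((σ (0 + 1)).1 - (σ 0).1) + (pinnedChain (1 : ℝ) 1 1 0).V ((σ 0).1 - (σ (0 - 1)).1)) / 2 = _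
    rw [hΦdef]
    ring
  have hΦint : Integrable Φ μ :=
    (hh1.sub ((hp2 0).div_const 2)).congr (Eventually.of_forall fun σ => by
      show h σ 0 - (σ 0).2 ^ 2 / 2 = Φ σ
      rw [hΦ σ]; ring)
  have hΦ2 : MemLp Φ 2 μ :=
    (hh2.sub ((hp2sq 0).const_mul (1 / 2))).ae_eq (Eventually.of_forall fun σ => by
      show h σ 0 - 1 / 2 * (σ 0).2 ^ 2 = Φ σ
      rw [hΦ σ]; ring)
  have hΦp_int : Integrable (fun σ => Φ σ * (σ 0).2 ^ 2) μ := hΦ2.integrable_mul (hp2sq 0)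
  have hΦp : ∫ σ, Φ σ * (σ 0).2 ^ 2 ∂μ = ∫ σ, Φ σ ∂μ := by
    have h0 := hG.integral_snd_mul_snd_mul hUc hVc one_pos 0 (g := g₀) hg₀
    calc ∫ σ, Φ σ * (σ 0).2 ^ 2 ∂μ
        = ∫ σ : ChainConfig, (σ 0).2 * (σ 0).2 * g₀ (fun x => (σ x).1) ∂μ :=
          integral_congr_ae (Eventually.of_forall fun σ => by
            show Φ σ * (σ 0).2 ^ 2 = (σ 0).2 * (σ 0).2 * Φ σ
            ring)
      _ = 1 * ∫ σ : ChainConfig, g₀ (fun x => (σ x).1) ∂μ := h0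
      _ = ∫ σ, Φ σ ∂μ := by rw [one_mul]
  have hm_eq : m = 1 / 2 + ∫ σ, Φ σ ∂μ := by
    calc m = ∫ σ, ((σ 0).2 ^ 2 / 2 + Φ σ) ∂μ := integral_congr_ae (Eventually.of_forall hΦ)
      _ = (∫ σ, (σ 0).2 ^ 2 / 2 ∂μ) + ∫ σ, Φ σ ∂μ := integral_add ((hp2 0).div_const 2) hΦint
      _ = 1 / 2 + ∫ σ, Φ σ ∂μ := by rw [integral_div, hp2one 0]
  have hp4gauss : ∫ σ, (σ 0).2 ^ 4 ∂μ = ∫ r, r ^ 4 ∂(gaussianReal 0 1) := by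
    have hmap := hG.map_snd hUc hVc one_pos 0
    rw [Real.toNNReal_one] at hmap
    rw [← hmap, integral_map (hmeas_p 0).aemeasurable (Continuous.aestronglyMeasurable (by fun_prop))]
  have hc : 0 < (∫ σ, h σ 0 * (σ 0).2 ^ 2 ∂μ) - m := by
    have e : ∫ σ, h σ 0 * (σ 0).2 ^ 2 ∂μ = 1 / 2 * ∫ σ, (σ 0).2 ^ 4 ∂μ + ∫ σ, Φ σ ∂μ := by
      calc ∫ σ, h σ 0 * (σ 0).2 ^ 2 ∂μ
          = ∫ σ, (1 / 2 * (σ 0).2 ^ 4 + Φ σ * (σ 0).2 ^ 2) ∂μ :=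
            integral_congr_ae (Eventually.of_forall fun σ => by
              show h σ 0 * (σ 0).2 ^ 2 = 1 / 2 * (σ 0).2 ^ 4 + Φ σ * (σ 0).2 ^ 2
              rw [hΦ σ]; ring)
        _ = 1 / 2 * ∫ σ, (σ 0).2 ^ 4 ∂μ + ∫ σ, Φ σ * (σ 0).2 ^ 2 ∂μ := by
            rw [integral_add ((hp4 0).const_mul _) hΦp_int, integral_const_mul]
        _ = 1 / 2 * ∫ σ, (σ 0).2 ^ 4 ∂μ + ∫ σ, Φ σ ∂μ := by rw [hΦp]
    rw [e, hm_eq, hp4gauss]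
    nlinarith [one_lt_integral_pow_four_gaussianReal]
  -- the pulse: `S(x,t) = (t²/2) (∫ h_0 p_{x-1}² dμ - m)`
  have hSform : ∀ (x : ℤ) (t : ℝ), S x t = t ^ 2 / 2 * ((∫ σ, h σ 0 * (σ (x - 1)).2 ^ 2 ∂μ) - m) := by
    intro x t
    have e : ∀ σ, (h σ 0 - m) * (h (D.flow t σ) x - m) =
        t ^ 2 / 2 * (h σ 0 * (σ (x - 1)).2 ^ 2) - (t ^ 2 / 2 * m) * (σ (x - 1)).2 ^ 2 - m * h σ 0 + m ^ 2 :=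
      fun σ => by rw [hflow]; ring
    have i1 : Integrable (fun σ => t ^ 2 / 2 * (h σ 0 * (σ (x - 1)).2 ^ 2)) μ := (hhp (x - 1)).const_mul _
    have i2 : Integrable (fun σ => (t ^ 2 / 2 * m) * (σ (x - 1)).2 ^ 2) μ := (hp2 (x - 1)).const_mul _
    have i3 : Integrable (fun σ => m * h σ 0) μ := hh1.const_mul _
    calc S x t = ∫ σ, (t ^ 2 / 2 * (h σ 0 * (σ (x - 1)).2 ^ 2) - (t ^ 2 / 2 * m) * (σ (x - 1)).2 ^ 2
          - m * h σ 0 + m ^ 2) ∂μ := integral_congr_ae (Eventually.of_forall e)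
      _ = t ^ 2 / 2 * (∫ σ, h σ 0 * (σ (x - 1)).2 ^ 2 ∂μ) - (t ^ 2 / 2 * m) * (∫ σ, (σ (x - 1)).2 ^ 2 ∂μ)
          - m * (∫ σ, h σ 0 ∂μ) + m ^ 2 := by
          have i12 : Integrable (fun σ => t ^ 2 / 2 * (h σ 0 * (σ (x - 1)).2 ^ 2)
              - (t ^ 2 / 2 * m) * (σ (x - 1)).2 ^ 2) μ := i1.sub i2
          have i123 : Integrable (fun σ => t ^ 2 / 2 * (h σ 0 * (σ (x - 1)).2 ^ 2)
              - (t ^ 2 / 2 * m) * (σ (x - 1)).2 ^ 2 - m * h σ 0) μ := i12.sub i3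
          rw [integral_add i123 (integrable_const _), integral_sub i12 i3,
            integral_sub i1 i2, integral_const_mul, integral_const_mul, integral_const_mul, hconst]
      _ = t ^ 2 / 2 * ((∫ σ, h σ 0 * (σ (x - 1)).2 ^ 2 ∂μ) - m) := by
          rw [hp2one (x - 1), ← hm]
          ring
  have hS0 : ∀ x : ℤ, x ≠ 1 → ∀ t : ℝ, S x t = 0 := fun x hx t => by
    rw [hSform, hA1 (x - 1) (sub_ne_zero.mpr hx), sub_self, mul_zero]
  have hS1 : ∀ t : ℝ, S 1 t = t ^ 2 / 2 * ((∫ σ, h σ 0 * (σ 0).2 ^ 2 ∂μ) - m) := fun t => by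
    rw [hSform, sub_self]
  -- the remaining hypotheses of the crux hold for the junk dynamics
  have hShift : ∀ t : ℝ, ∀ᵐ σ ∂μ, D.flow t (shift σ) = shift (D.flow t σ) := fun t =>
    Eventually.of_forall fun σ => funext fun x => by
      show ((0 : ℝ), t * (σ (x - 1 + 1)).2) = ((0 : ℝ), t * (σ (x + 1 - 1)).2)
      rw [sub_add_cancel, add_sub_cancel_right]
  have hSumm : ∀ t : ℝ, Summable (fun x : ℤ => (1 + (x : ℝ) ^ 2) * |S x t|) := fun t =>
    summable_of_ne_finset_zero (s := {1}) fun x hx => by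
      rw [Finset.mem_singleton] at hx
      rw [hS0 x hx t, abs_zero, mul_zero]
  have hM : ∀ t : ℝ, ∑' x : ℤ, (x : ℝ) ^ 2 * S x t = ((∫ σ, h σ 0 * (σ 0).2 ^ 2 ∂μ) - m) / 2 * t ^ 2 := by
    intro t
    rw [tsum_eq_single 1 (fun x hx => by rw [hS0 x hx t, mul_zero]), hS1]
    push_cast
    ring
  -- apply the mutated crux and conclude with the quadratic kernel
  obtain ⟨b, t₃, hb⟩ := H 1 1 1 0 one_pos one_pos one_pos 1 one_pos μ hG hSI hR D hShift h rfl S rfl hSumm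
  exact not_anchoredLinearEnvelope_of_eq_quadratic (M := fun t => ∑' x : ℤ, (x : ℝ) ^ 2 * S x t)
    (half_pos hc) hM ⟨b, t₃, hb⟩

end Summit.AtomisticToContinuum.FouriersLaw.Theorems.LinearCeiling.Negative

end
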